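import Literature.AlgebraicGeometry.HodgeTheory.AbelianVarietyHodgeEssentialImageHolds
import Literature.AlgebraicGeometry.HodgeTheory.WeilTypeRationalDatum
import Literature.AlgebraicGeometry.HodgeTheory.HodgeStructureOfHodgeModel
import Literature.AlgebraicGeometry.Motives.WeilDatumHodgeStructure
import Literature.AlgebraicGeometry.Motives.HodgeStructureDirectSum
import Literature.AlgebraicGeometry.Motives.HodgeStructureAnalyticRepresentationFaithful
import HarnessLib

/-!
# Route `EightfoldBlochSeeds`, crux `ReachHyperbolic` (item stmt-HodgeConjecture-18883), line `moduli-riemann`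
# (`Cruxes/ReachHyperbolic/Lines/moduli_riemann.lean` 1ba65e5152037605), stub `stub_riemannRealisable` — ITS HODGE HALF:
# every Weil complex structure `J` on the rational Weil datum of `(P, ψ₀, h_K)` is the `H¹` of a complex ABELIAN VARIETY
# `B` with `dim B = dim P`, marked by a `ℚ`-isomorphism `β : H¹(P) ≅ H¹(B)` carrying `H^{1,0}_J` into `H^{1,0}(B)`

HONEST FRAMING. Nothing here proves the stub, the crux, rung H2, HC_AV or the Hodge conjecture. UNCONDITIONAL theorems
(no named fact as hypothesis, no definition, no Literature fact introduced — D-0026). Census-neutral.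

WHAT IS HERE (leafhand `leafhand-hodge-eightfoldblochseed-1-g0`). The registered transcendental stub asks, for every
Weil complex structure `J ∈ X⁺` on the datum `weilDatumOfKsymm …` of a Weil-type `(P, ψ₀)`, for `(B, Φ, β)` with
`RealisedBy n d … J hW B Φ β`: `dim B = 2n`, `Φ ≫ Φ = -d`, `β ∘ ψ₀^* = Φ^* ∘ β`, and `β ⊗ ℂ` carries the `(1,0)`-piece of
`J`'s Hodge structure into `H^{1,0}(B)` (`IsOfHodgeType (2n) B.X 1 1 0`). Its line card says «Leans on: nothing in Mathlib (no
complex tori / theta functions); tree has only the converse `hodgeIso_bettiOne_isogeny`». That census is OUTDATED: the tree holds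
Riemann's existence theorem in Deligne–Milne's form — `HodgeTheory.exists_abelianVariety_bettiOneHodgeStructure_hom_bijective`
(every finite-dimensional polarisable effective weight-one `ℚ`-Hodge structure is `H¹_B` of a complex abelian variety, with
`2·dim = rank`; polarised tori are abelian varieties by theta functions, Chow and GAGA: `AbelianVarieties.exists_abelianVariety_of_isAbelianVariety`).
This file spends it on the stub and proves the stub's HODGE HALF (everything except the `√-d`-action `Φ` and the intertwining):

* `isOfHodgeType_of_mem_piece_bettiOneHodgeStructure` — junction: a class in the `(1,0)`-piece of `H¹_B(B)` read through a
  Hodge-symmetric Hodge model `M` (`bettiOneHodgeStructure B M hM`) is of Hodge type `(1,0)` in the tree's model-free sense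
  (`IsOfHodgeType`, witness `M`; `HodgeModel.piece_eq_ratPiece`, `mem_ratPiece_iff`).
* `exists_abelianVariety_marking_of_isWeilComplexStructure` — **for every `(P, ψ₀, e, a, ω)` as in the stub and every Weil
  complex structure `J` (`Motives.IsWeilComplexStructure`), there are a complex abelian variety `B` with `dim B = dim P` and a
  `ℚ`-linear ISOMORPHISM `β : H¹(P(ℂ); ℚ) ≃ H¹(B(ℂ); ℚ)` such that `β ⊗ ℂ` maps the `(1,0)`-piece of
  `(weilDatumOfKsymm …).hodgeStructure J` into `H^{1,0}(B)`** — the Hodge structure of `J` is polarised by the datum's Riemann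
  form (`WeilDatum.isPolarizable_hodgeStructure`, van Geemen 5.6) and effective (`isEffective_hodgeStructureOfCx`), Riemann's
  theorem gives `B` and a bijective Hodge morphism, whose inverse (`Hom.symmOfBijective`, Deligne Hodge II 2.3.5 (iii)) maps
  pieces to pieces (`Hom.baseChange_mapsTo_piece`); `dim B = dim P` by `b₁ = 2·dim` (`finrank_bettiCohomology_one`).
* `exists_abelianVariety_marking_of_isWeilComplexStructure_two_mul` — the same with `dim B = 2n` from `dim P = 2n` (the stub's
  shape: the conclusion is `RealisedBy n d …` with the two `Φ`-clauses deleted).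

WHAT IS NOT HERE = the `K`-half of the stub: an endomorphism `Φ` of `B` with `Φ ≫ Φ = -d` EXACTLY and `β ∘ ψ₀^* = Φ^* ∘ β`.
Road (all bricks in the tree, assembly not done): `ψ₀^*` is a Hodge endomorphism of `J`'s structure (`J` is `K ⊗ ℝ`-linear,
`WeilDatum.αℝ_realJ`); Riemann FULLNESS (`DeligneMilne1982_Thm_6_20_full_holds` / `exists_hom_map_eq_nsmul_of_oneZero`) gives
`u ∈ End B`, `k ≥ 1` with `u^* = k·(β ψ₀^* β⁻¹)`, hence `u² = -k²d` by faithfulness (`AbelianVariety.hom_eq_of_bettiCohomology_map_one_eq`)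
— an endomorphism of square `-k²d`, not `-d`; the exact `d` needs an isogenous model of `B` whose `H¹`-lattice is
`β ψ₀^* β⁻¹`-stable (cf. the tree's `exists_principalModel`, Shimura §7.1 Prop. 7, as used in
`ComplexMultiplication.cmAbelianVarietyRealised_of_riemann`) — SIZE: M (≈ 200–400 lines of assembly), no new mathematics.

## References

[cite: DeligneMilne1982Tannakian, art. II §6 Thm. 6.20 (Riemann)] [cite: vanGeemen1994HodgeAV, 5.5–5.7]
[cite: Deligne1982HodgeCycles, proof of Thm. 4.8, p. 47 (a')(b)] [cite: DeligneHodgeII1971, Thm. 2.3.5 (iii)]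
[cite: LangeBirkenhake1992, Lemma 1.1.17, Thm. 4.2.1] [cite: VoisinHodgeI2002, §7.1.1 and §7.2.2]
-/

noncomputable section

-- single-problem summit (Problem = Summit): the mandated namespace repeats `HodgeConjecture`.
set_option linter.dupNamespace false

open CategoryTheory AlgebraicGeometry
open scoped TensorProduct
open Literature.AlgebraicGeometry Literature.AlgebraicGeometry.Motives Literature.AlgebraicGeometry.HodgeTheory
open Literature.AlgebraicTopology.SingularHomology

namespace Summit.HodgeConjecture.HodgeConjecture.Theorems

/-! ## §1 Junction: the `(1,0)`-piece of `H¹_B(B)` read in a model is of Hodge type `(1,0)` -/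

/-- **Junction.** For a complex abelian variety `B` and a Hodge-symmetric Hodge model `M`, a class of `ℂ ⊗_ℚ H¹(B(ℂ); ℚ)` in
the `(1,0)`-piece of `bettiOneHodgeStructure B M hM` is of Hodge type `(1,0)` in the model-free sense `IsOfHodgeType` (witness:
`M` itself — the piece is `Θ_M⁻¹(H^{1,0})`, `HodgeModel.piece_eq_ratPiece`, and `Θ_M` is `ofRatClassBaseChange` followed by the
pull-back to the model, `HodgeModel.complexification_apply`). [cite: VoisinHodgeI2002, §7.1.1 Def. 7.4] -/
theorem isOfHodgeType_of_mem_piece_bettiOneHodgeStructure (B : AbelianVariety ℂ) (M : HodgeModel B.dim B.X)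
    (hM : M.IsHodgeSymmetric) {y : ℂ ⊗[ℚ] bettiCohomology B.X 1}
    (hy : y ∈ (bettiOneHodgeStructure B M hM).piece 1 0) :
    IsOfHodgeType B.dim B.X 1 1 0 (Motives.ofRatClassBaseChange (ComplexPoints B.X) 1 y) := by
  have h1 : (bettiOneHodgeStructure B M hM).piece 1 0 =
      M.ratPiece AbelianVariety.isSmoothProjective_holds 1 1 0 := by
    rw [bettiOneHodgeStructure, Motives.HodgeStructure.cast_piece]
    exact_mod_cast M.piece_eq_ratPiece AbelianVariety.isSmoothProjective_holds hM (show 1 + 0 = 1 from rfl)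
  rw [h1, HodgeModel.mem_ratPiece_iff, HodgeModel.complexification_apply] at hy
  exact ⟨M, hy⟩

/-! ## §2 The Hodge half of `stub_riemannRealisable`: Riemann's existence theorem at a Weil complex structure -/

section Realise

variable {d : ℕ} {P : AbelianVariety ℂ} {ψ₀ : P ⟶ P} (e : ProjectiveEmbedding P.X)
  {a : complexBetti (projectiveSpace e.n ℂ) 2} (ha : IsRationalClass a) (ha0 : a ≠ 0)
  {m : ℕ} (hm : 1 ≤ m) (hPm : P.dim = m + 1) (hd' : 0 < d) (hψ : ψ₀ ≫ ψ₀ = -(d • 𝟙 P))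
  {ω : complexBetti P.X (2 + 2 * m)} (hω : IsRationalClass ω) (hω0 : ω ≠ 0)

/-- **Every Weil complex structure is the `H¹` of an abelian variety of the same dimension, with a marking carrying `H^{1,0}_J`
into `H^{1,0}(B)`.** For `(P, ψ₀, e, a, ω)` as in `stub_riemannRealisable` and `J ∈ X⁺` (`IsWeilComplexStructure` for the datum's
hermitian form): the weight-one Hodge structure of `J` on `H¹(P(ℂ); ℚ)` is polarised by the datum's Riemann form and effective, so
Riemann's theorem (`exists_abelianVariety_bettiOneHodgeStructure_hom_bijective`) realises it as `H¹_B(B)` of a complex abelian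
variety `B`, `2·dim B = b₁(P) = 2·dim P`; the inverse Hodge isomorphism `β` maps the `(1,0)`-piece into `H^{1,0}(B)` (§1).
[cite: DeligneMilne1982Tannakian, art. II §6 Thm. 6.20 (Riemann)] [cite: vanGeemen1994HodgeAV, 5.6–5.7]
[cite: DeligneHodgeII1971, Thm. 2.3.5 (iii)] -/
theorem exists_abelianVariety_marking_of_isWeilComplexStructure
    (J : (weilDatumOfKsymm hm hPm hd' hψ e ha ha0 hω hω0).Cx →ₗ[ℂ] (weilDatumOfKsymm hm hPm hd' hψ e ha ha0 hω hω0).Cx)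
    (hW : Motives.IsWeilComplexStructure (weilDatumOfKsymm hm hPm hd' hψ e ha ha0 hω hω0).hForm J) :
    ∃ (B : AbelianVariety ℂ) (β : bettiCohomology P.X 1 ≃ₗ[ℚ] bettiCohomology B.X 1),
      B.dim = P.dim ∧
      ∀ x ∈ ((weilDatumOfKsymm hm hPm hd' hψ e ha ha0 hω hω0).hodgeStructure J hW.sq).piece 1 0,
        IsOfHodgeType B.dim B.X 1 1 0
          (Motives.ofRatClassBaseChange (ComplexPoints B.X) 1 (β.toLinearMap.baseChange ℂ x)) := by
  haveI : Module.Finite ℚ (bettiCohomology P.X 1) := finite_bettiCohomology_one P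
  set H := (weilDatumOfKsymm hm hPm hd' hψ e ha ha0 hω hω0).hodgeStructure J hW.sq with hHdef
  have hpol : H.IsPolarizable := (weilDatumOfKsymm hm hPm hd' hψ e ha ha0 hω hω0).isPolarizable_hodgeStructure J hW
  have heff : H.IsEffective := Motives.HodgeStructure.isEffective_hodgeStructureOfCx _ _
  obtain ⟨B, M, hM, f, hf, hdim⟩ := exists_abelianVariety_bettiOneHodgeStructure_hom_bijective H hpol heff
  refine ⟨B, LinearEquiv.ofBijective (f.symmOfBijective hf).toLinearMap (f.symmOfBijective_bijective hf), ?_, ?_⟩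
  · have h2 := finrank_bettiCohomology_one P
    omega
  · intro x hx
    exact isOfHodgeType_of_mem_piece_bettiOneHodgeStructure B M hM
      ((f.symmOfBijective hf).baseChange_mapsTo_piece 1 0 hx)

/-- **The Hodge half of `stub_riemannRealisable`, in the stub's shape** (`dim P = 2n` ⟹ `dim B = 2n`; the conclusion is the body
of the skeleton's `RealisedBy n d … J hW B Φ β` with its two `Φ`-clauses — `Φ ≫ Φ = -d` and the intertwining `β ∘ ψ₀^* = Φ^* ∘ β`
— deleted). [cite: DeligneMilne1982Tannakian, art. II §6 Thm. 6.20 (Riemann)] [cite: Deligne1982HodgeCycles, proof of Thm. 4.8, p. 47] -/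
theorem exists_abelianVariety_marking_of_isWeilComplexStructure_two_mul {n : ℕ} (hP : P.dim = 2 * n)
    (J : (weilDatumOfKsymm hm hPm hd' hψ e ha ha0 hω hω0).Cx →ₗ[ℂ] (weilDatumOfKsymm hm hPm hd' hψ e ha ha0 hω hω0).Cx)
    (hW : Motives.IsWeilComplexStructure (weilDatumOfKsymm hm hPm hd' hψ e ha ha0 hω hω0).hForm J) :
    ∃ (B : AbelianVariety ℂ) (β : bettiCohomology P.X 1 ≃ₗ[ℚ] bettiCohomology B.X 1),
      B.dim = 2 * n ∧
      ∀ x ∈ ((weilDatumOfKsymm hm hPm hd' hψ e ha ha0 hω hω0).hodgeStructure J hW.sq).piece 1 0,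
        IsOfHodgeType (2 * n) B.X 1 1 0
          (Motives.ofRatClassBaseChange (ComplexPoints B.X) 1 (β.toLinearMap.baseChange ℂ x)) := by
  obtain ⟨B, β, hB, hβ⟩ := exists_abelianVariety_marking_of_isWeilComplexStructure e ha ha0 hm hPm hd' hψ hω hω0 J hW
  refine ⟨B, β, by rw [hB, hP], fun x hx => ?_⟩
  rw [← hP, ← hB]
  exact hβ x hx

end Realise

end Summit.HodgeConjecture.HodgeConjecture.Theorems

end
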